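import Summits.CriticalPhenomena.PercolationContinuityZ3.Theorems.FK.MagnetizationExponentialLLN
import Summits.CriticalPhenomena.PercolationContinuityZ3.Theorems.FK.FieldStrictMonotonicity
import Summits.CriticalPhenomena.PercolationContinuityZ3.Theorems.FK.FieldSaturation
import Summits.CriticalPhenomena.PercolationContinuityZ3.Theorems.FK.ImproperSusceptibilitySumRule
import HarnessLib

/-!
# LARGE DEVIATIONS OF THE MAGNETISATION ON `ℤ^d`, II: THE TILTING LOWER BOUND, THE LEGENDRE RATE AT EXPOSED POINTS,
# THE COEXISTENCE PLATEAU `[−m*(β), m*(β)]`, AND THE LARGE-DEVIATION PRINCIPLE AT ZERO FIELD ON `m*(β) < |a| < 1`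
# (Ellis 2006, Thm. II.6.1 (b)–(c), (4.34), Thm. V.6.1; Lanford 1973)

Claimed R42 (8)(c) in the cell INBOX at 2026-08-29T07:20:29Z by fkp-10a gen 359 (NEW CLAIM #1 of the gen), addressed to the lane under (ι) (coordinator fk-4 gen 293 CLOSED l.8789 06:52:14Z 2026-08-29; «(ι) RESUMES») and to the next seated fk-4 generation (ruling R172 requested); lineage row FO-10a-g359 (self-suggested), package g359-largedev, label LD-D.
Helper file of the `fk-continuity` build cell (bschramm lane; `--supports stmt-CriticalPhenomena-4575`); builds on
p205010 (kernel theorem, internal audit signed; external expert review pending). No definitions, no named facts, no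
sorries; standard axioms. UNCONDITIONAL (nearest-neighbour Ising model; `μ_N = μ^{bc}_{Λ_N;β,h}` on the boxes
`Λ_N = {−N,…,N}^d` of `ℤ^d`, EVERY boundary condition; `M_N = Σ_{x∈Λ_N} σ_x`; `ψ(β,h) = pressure d β h`).

Ellis (2006) Thm. II.6.1: with the free energy function `c_{β,h}(βs) = ψ(β,h+s) − ψ(β,h)` of the total spin
((4.33), file `MagnetizationLargeDeviations`), the upper bound holds with the Legendre transform
`I_{β,h}(a) = sup_s {βsa − (ψ(β,h+s) − ψ(β,h))}` ((4.34)), and the LOWER bound `liminf |Λ|⁻¹ log Q_Λ(G) ≥ −inf_G I`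
holds where `c` is differentiable (proof, §VII.4: tilt the measure to the exposed point and use the law of large
numbers there). Here, without definitions (the rate is written out at the optimising `s`):

* **`exp_mul_measureReal_window_le`** (finite volume, ANY graph/volume/b.c., all real `β,h,s,a,δ`) — THE TILTING
  INEQUALITY `e^{−βsa − |βs|δ} (Z_{h+s}/Z_h) μ_{h+s}{|M_Λ − a| < δ} ≤ μ_h{|M_Λ − a| < δ}` (`μ_h = μ_{h+s}` tilted by
  `e^{−βs M_Λ}`); `eventually_exp_le_measureReal_window` (`ℤ^d`) — a window of `μ_{N;β,h+s}`-mass `≥ 1/2` has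
  `μ_{N;β,h}`-mass `≥ exp(−|Λ_N| (βsa − (ψ(β,h+s) − ψ(β,h)) + |βs|δ + ε))` eventually;
* **`ld_lower_bound_of_hasDerivAt`** — THE LOWER LARGE-DEVIATION BOUND AT AN EXPOSED POINT: if `ψ(β,·)` is
  differentiable at `h + s` with derivative `D` (`β > 0`, `d ≥ 1`), then for every `δ, ε > 0` and every boundary
  condition, eventually `exp(−|Λ_N| (sD − (ψ(β,h+s) − ψ(β,h)) + |βs|δ + ε)) ≤ μ^{bc}_{Λ_N;β,h}{|M_N/|Λ_N| − D/β| < δ}`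
  (the window at field `h + s` has mass `→ 1` by `exp_concentration_of_hasDerivAt`);
* `pressure_tangent_le`, **`rate_le_rate_of_hasDerivAt`** — THE LEGENDRE TRANSFORM IS ATTAINED AT THE EXPOSING FIELD:
  `βum − (ψ(β,h+u) − ψ(β,h)) ≤ βsm − (ψ(β,h+s) − ψ(β,h))` for every `u` when `ψ'(h+s) = βm` (convexity), so the
  exponent of the lower bound IS Ellis' `I_{β,h}(m)` and matches the upper bound of `MagnetizationLargeDeviations`;
* `rate_nonpos_of_mem_Icc` / **`rate_nonpos_zero_field_of_abs_le_spontaneousMagnetization`** — THE COEXISTENCE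
  PLATEAU: `βua − (ψ(β,h+u) − ψ(β,h)) ≤ 0` for every `u` when `∂⁻ψ/∂h ≤ βa ≤ ∂⁺ψ/∂h`; at `h = 0`: `I_{β,0}(a) = 0`
  for `|a| ≤ m*(β)` (the volume-order rate vanishes on `[−m*, m*]`, Ellis V.6.1 (d)–(e));
* ZERO FIELD, `β > 0`, `d ≥ 1`, every field `k > 0` (exposed point `a = m(β,k)`, rate `I_k = βk m(β,k) − (ψ(β,k) − ψ(β,0))`):
  **`rate_pos_zero_field`** (`0 < I_k`), **`ld_upper_zero_field`** (`μ^{bc}_{Λ_N;β,0}{M_N ≥ m(β,k)|Λ_N|} ≤ e^{−|Λ_N|(I_k − ε)}`),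
  **`ld_lower_zero_field`** (`e^{−|Λ_N|(I_k + βkδ + ε)} ≤ μ^{bc}_{Λ_N;β,0}{|M_N/|Λ_N| − m(β,k)| < δ}`), the mirror images
  `ld_upper/lower_zero_field_neg` at `a = −m(β,k)`, `rate_zero_field_le_rate`, and **`exists_pos_field_magnetizationInField_eq`**
  — every `a ∈ (m*(β), 1)` IS exposed (`a = m(β,k)`, `k > 0`): THE LARGE-DEVIATION PRINCIPLE FOR `M_N/|Λ_N|` UNDER
  `μ^{bc}_{Λ_N;β,0}` WITH THE CONVEX RATE `I_{β,0}` ON `{m* < |a| < 1}`, EVERY BOUNDARY CONDITION; `I_{β,0} ≡ 0` on `[−m*, m*]`.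

## References

* R. S. Ellis, *Entropy, Large Deviations, and Statistical Mechanics*, Springer (1985/2006), Thm. II.6.1 (b)–(c)
  and Example II.6.2, (2.28), Thm. II.6.3, §IV.5 (4.33)–(4.34), §V.6 Thm. V.6.1 (c)–(e), Note 13 to Ch. IV,
  §VII.4 (proof of the lower bound by tilting). [Ellis2006]
* O. E. Lanford, *Entropy and equilibrium states in classical statistical mechanics*, LNP 20 (1973). [Lanford1973]
* S. Friedli, Y. Velenik, *Statistical Mechanics of Lattice Systems*, CUP (2017), Prop. 3.29, Thm. 3.43. [FriedliVelenik2017]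
-/

noncomputable section

namespace Summit.CriticalPhenomena.PercolationContinuityZ3.Theorems.FK

namespace IsingLargeDeviations

open MeasureTheory ProbabilityTheory Filter Topology Finset Set
open Literature.Probability.LatticeModels

/-! ### Finite volume: the tilting inequality -/

section FiniteVolume

variable {V : Type*} (G : SimpleGraph V) [DecidableEq V] [G.LocallyFinite]

omit [DecidableEq V] in
/-- The total-spin window `{σ | |M_Λ(σ) − a| < δ}` is measurable. [folklore] -/
theorem measurableSet_window (Λ : Finset V) (a δ : ℝ) :
    MeasurableSet {σ : SpinConfig V | |∑ x ∈ Λ, spinAt x σ - a| < δ} :=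
  measurableSet_lt ((measurable_sum_spinAt Λ).sub_const a).abs measurable_const

/-- **THE TILTING INEQUALITY: `e^{−βsa − |βs|δ} · (Z_{h+s}/Z_h) · μ^{bc}_{Λ;β,h+s}{|M_Λ − a| < δ} ≤ μ^{bc}_{Λ;β,h}{|M_Λ − a| < δ}`**
(any locally finite graph, any volume and boundary condition, all real `β, h, s, a, δ`): `μ_h` is `μ_{h+s}` tilted by
`e^{−βs M_Λ}` with normalisation `Z_h/Z_{h+s}`, and `e^{−βs M_Λ} ≥ e^{−βsa − |βs|δ}` on the window.
[cite: Ellis2006, Thm. II.6.1 (c) (proof, §VII.4) with §IV.5 eq. (4.33)] -/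
theorem exp_mul_measureReal_window_le (Λ : Finset V) (β h s : ℝ) (bc : BoundaryCondition V) (a δ : ℝ) :
    Real.exp (-(β * s * a) - |β * s| * δ) *
        (isingPartitionFunction G Λ β (h + s) bc / isingPartitionFunction G Λ β h bc) *
        (isingMeasure G Λ β (h + s) bc).real {σ | |∑ x ∈ Λ, spinAt x σ - a| < δ} ≤
      (isingMeasure G Λ β h bc).real {σ | |∑ x ∈ Λ, spinAt x σ - a| < δ} := by
  set ν := isingMeasure G Λ β (h + s) bc with hν
  set W : Set (SpinConfig V) := {σ | |∑ x ∈ Λ, spinAt x σ - a| < δ} with hW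
  have hWm : MeasurableSet W := measurableSet_window Λ a δ
  set f : SpinConfig V → ℝ := fun σ => β * -s * ∑ x ∈ Λ, spinAt x σ with hf
  have hμ : isingMeasure G Λ β h bc = ν.tilted f := by
    have := isingMeasure_add_field_eq_tilted G Λ β (h + s) (-s) bc
    rwa [add_neg_cancel_right] at this
  have hnorm : ∫ σ, Real.exp (f σ) ∂ν = isingPartitionFunction G Λ β h bc / isingPartitionFunction G Λ β (h + s) bc := by
    have := integral_exp_mul_sum_spinAt G Λ β (h + s) (-s) bc
    rwa [add_neg_cancel_right] at this
  have hZ : 0 < isingPartitionFunction G Λ β h bc := isingPartitionFunction_pos G Λ β h bc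
  have hZ' : 0 < isingPartitionFunction G Λ β (h + s) bc := isingPartitionFunction_pos G Λ β _ bc
  have hnorm_pos : 0 < ∫ σ, Real.exp (f σ) ∂ν := by rw [hnorm]; positivity
  have hreal : (isingMeasure G Λ β h bc).real W = ∫ σ in W, Real.exp (f σ) / ∫ σ', Real.exp (f σ') ∂ν ∂ν := by
    rw [measureReal_def, hμ, tilted_apply_eq_ofReal_integral' f hWm, ENNReal.toReal_ofReal]
    exact setIntegral_nonneg hWm fun σ _ => by positivity
  set c : ℝ := Real.exp (-(β * s * a) - |β * s| * δ) *
    (isingPartitionFunction G Λ β (h + s) bc / isingPartitionFunction G Λ β h bc) with hc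
  have hbound : ∀ σ ∈ W, c ≤ Real.exp (f σ) / ∫ σ', Real.exp (f σ') ∂ν := by
    intro σ hσ
    have hσ' : |∑ x ∈ Λ, spinAt x σ - a| < δ := hσ
    have h1 : β * s * (∑ x ∈ Λ, spinAt x σ - a) ≤ |β * s| * δ :=
      (le_abs_self _).trans (by rw [abs_mul]; exact mul_le_mul_of_nonneg_left hσ'.le (abs_nonneg _))
    have hexp : Real.exp (-(β * s * a) - |β * s| * δ) ≤ Real.exp (f σ) := by
      simp only [hf, Real.exp_le_exp]
      linarith
    rw [hnorm, div_eq_mul_inv, inv_div, hc]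
    exact mul_le_mul_of_nonneg_right hexp (div_pos hZ' hZ).le
  have hint : IntegrableOn (fun σ => Real.exp (f σ) / ∫ σ', Real.exp (f σ') ∂ν) W ν :=
    ((integrable_exp_mul_sum_spinAt Λ ν (β * -s)).div_const _).integrableOn
  have := setIntegral_ge_of_const_le_real hWm (measure_ne_top ν W) hbound hint
  rw [← hreal] at this
  simpa only [hc, mul_assoc] using this

end FiniteVolume

/-! ### `ℤ^d`: the lower bound from a window of mass `≥ 1/2` at the tilted field -/

variable {d : ℕ}

/-- The density window equals the total-spin window: `{|M/|Λ| − a| < δ} = {|M − a|Λ|| < δ|Λ|}` (nonempty `Λ`). [folklore] -/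
theorem setOf_abs_div_sub_lt_eq {Λ : Finset (Site d)} (hΛ : Λ.Nonempty) (a δ : ℝ) :
    {σ : SpinConfig (Site d) | |(∑ x ∈ Λ, spinAt x σ) / #Λ - a| < δ} =
      {σ | |∑ x ∈ Λ, spinAt x σ - a * #Λ| < δ * #Λ} := by
  have hV : (0 : ℝ) < #Λ := by exact_mod_cast hΛ.card_pos
  ext σ
  simp only [mem_setOf_eq]
  rw [show (∑ x ∈ Λ, spinAt x σ) / #Λ - a = (∑ x ∈ Λ, spinAt x σ - a * #Λ) / #Λ by field_simp,
    abs_div, abs_of_pos hV, div_lt_iff₀ hV]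

/-- **LOWER BOUND FROM A MASSIVE WINDOW AT THE TILTED FIELD** (`d ≥ 1`): if eventually
`μ^{bc}_{Λ_N;β,h+s}{|M_N/|Λ_N| − a| < δ} ≥ 1/2`, then for every `ε > 0`, eventually
`exp(−|Λ_N| (βsa − (ψ(β,h+s) − ψ(β,h)) + |βs|δ + ε)) ≤ μ^{bc}_{Λ_N;β,h}{|M_N/|Λ_N| − a| < δ}`.
[cite: Ellis2006, Thm. II.6.1 (c) (proof, §VII.4)] -/
theorem eventually_exp_le_measureReal_window (hd : 1 ≤ d) (β h s : ℝ) (bc : BoundaryCondition (Site d)) (a δ : ℝ)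
    (hW : ∀ᶠ N : ℕ in atTop, (1 / 2 : ℝ) ≤
      (isingMeasure (zdGraph d) (box d N) β (h + s) bc).real {σ | |(∑ x ∈ box d N, spinAt x σ) / #(box d N) - a| < δ})
    {ε : ℝ} (hε : 0 < ε) :
    ∀ᶠ N : ℕ in atTop,
      Real.exp (-(#(box d N) * (β * s * a - (pressure d β (h + s) - pressure d β h) + |β * s| * δ + ε))) ≤
        (isingMeasure (zdGraph d) (box d N) β h bc).real {σ | |(∑ x ∈ box d N, spinAt x σ) / #(box d N) - a| < δ} := by
  have hev1 : ∀ᶠ N : ℕ in atTop, pressure d β (h + s) - pressure d β h - ε / 2 <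
      pressureIn (zdGraph d) (box d N) β (h + s) bc - pressureIn (zdGraph d) (box d N) β h bc :=
    (tendsto_pressureIn_sub (d := d) β h s bc).eventually (lt_mem_nhds (by linarith))
  have hcard : Tendsto (fun N : ℕ => (#(box d N) : ℝ)) atTop atTop := by
    refine tendsto_atTop_mono (fun N => ?_) tendsto_natCast_atTop_atTop
    have h1 : N ≤ #(box d N) := by
      rw [card_box]
      exact (show N ≤ 2 * N + 1 by omega).trans (Nat.le_self_pow (by omega) _)
    exact_mod_cast h1
  have hev2 : ∀ᶠ N : ℕ in atTop, Real.exp (-(ε / 2 * #(box d N))) ≤ 1 / 2 := by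
    have h1 : Tendsto (fun N : ℕ => Real.exp (-(ε / 2 * (#(box d N) : ℝ)))) atTop (𝓝 0) :=
      Real.tendsto_exp_atBot.comp (tendsto_neg_atTop_atBot.comp (hcard.const_mul_atTop (by positivity)))
    exact h1.eventually (eventually_le_nhds (by norm_num))
  filter_upwards [hW, hev1, hev2] with N hN h1 h2
  have hΛ := box_nonempty d N
  have hV : (0 : ℝ) < #(box d N) := by exact_mod_cast hΛ.card_pos
  have htilt := exp_mul_measureReal_window_le (zdGraph d) (box d N) β h s bc (a * #(box d N)) (δ * #(box d N))
  rw [← setOf_abs_div_sub_lt_eq hΛ, isingPartitionFunction_div_eq_exp_card_mul (zdGraph d) hΛ] at htilt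
  refine le_trans ?_ htilt
  have hpos1 : 0 < Real.exp (-(β * s * (a * #(box d N))) - |β * s| * (δ * #(box d N))) *
      Real.exp (#(box d N) * (pressureIn (zdGraph d) (box d N) β (h + s) bc - pressureIn (zdGraph d) (box d N) β h bc)) :=
    by positivity
  calc Real.exp (-(#(box d N) * (β * s * a - (pressure d β (h + s) - pressure d β h) + |β * s| * δ + ε)))
      = Real.exp (-(β * s * (a * #(box d N))) - |β * s| * (δ * #(box d N))) *
          Real.exp (#(box d N) * (pressure d β (h + s) - pressure d β h - ε / 2)) *
          Real.exp (-(ε / 2 * #(box d N))) := by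
        rw [← Real.exp_add, ← Real.exp_add]; congr 1; ring
    _ ≤ Real.exp (-(β * s * (a * #(box d N))) - |β * s| * (δ * #(box d N))) *
          Real.exp (#(box d N) * (pressureIn (zdGraph d) (box d N) β (h + s) bc -
            pressureIn (zdGraph d) (box d N) β h bc)) * (1 / 2) :=
        mul_le_mul (mul_le_mul_of_nonneg_left (Real.exp_le_exp.2 (mul_le_mul_of_nonneg_left h1.le hV.le))
          (Real.exp_pos _).le) h2 (Real.exp_pos _).le (by positivity)
    _ ≤ _ := mul_le_mul_of_nonneg_left hN hpos1.le

/-- **THE LOWER LARGE-DEVIATION BOUND AT AN EXPOSED POINT** (`d ≥ 1`, `β > 0`): if `ψ(β,·)` is differentiable at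
`h + s` with derivative `D`, then for every `δ > 0`, `ε > 0` and EVERY boundary condition, eventually
`exp(−|Λ_N| (sD − (ψ(β,h+s) − ψ(β,h)) + |βs|δ + ε)) ≤ μ^{bc}_{Λ_N;β,h}{|M_N/|Λ_N| − D/β| < δ}`: the window around the
exposed point `D/β` has mass `→ 1` under the tilted states `μ^{bc}_{Λ_N;β,h+s}` (`exp_concentration_of_hasDerivAt`).
[cite: Ellis2006, Thm. II.6.1 (c) and Thm. II.6.3; Lanford1973] -/
theorem ld_lower_bound_of_hasDerivAt (hd : 1 ≤ d) {β : ℝ} (hβ : 0 < β) {h s D : ℝ}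
    (hD : HasDerivAt (fun t => pressure d β t) D (h + s)) {δ : ℝ} (hδ : 0 < δ) {ε : ℝ} (hε : 0 < ε)
    (bc : BoundaryCondition (Site d)) :
    ∀ᶠ N : ℕ in atTop,
      Real.exp (-(#(box d N) * (s * D - (pressure d β (h + s) - pressure d β h) + |β * s| * δ + ε))) ≤
        (isingMeasure (zdGraph d) (box d N) β h bc).real
          {σ | |(∑ x ∈ box d N, spinAt x σ) / #(box d N) - D / β| < δ} := by
  obtain ⟨c, hc, hconc⟩ := exp_concentration_of_hasDerivAt hd hβ hD hδ
  have hW : ∀ᶠ N : ℕ in atTop, (1 / 2 : ℝ) ≤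
      (isingMeasure (zdGraph d) (box d N) β (h + s) bc).real
        {σ | |(∑ x ∈ box d N, spinAt x σ) / #(box d N) - D / β| < δ} := by
    have hcard : Tendsto (fun N : ℕ => (#(box d N) : ℝ)) atTop atTop := by
      refine tendsto_atTop_mono (fun N => ?_) tendsto_natCast_atTop_atTop
      have h1 : N ≤ #(box d N) := by
        rw [card_box]
        exact (show N ≤ 2 * N + 1 by omega).trans (Nat.le_self_pow (by omega) _)
      exact_mod_cast h1
    have hsmall : ∀ᶠ N : ℕ in atTop, Real.exp (-(c * #(box d N))) ≤ 1 / 2 := by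
      have h1 : Tendsto (fun N : ℕ => Real.exp (-(c * (#(box d N) : ℝ)))) atTop (𝓝 0) :=
        Real.tendsto_exp_atBot.comp (tendsto_neg_atTop_atBot.comp (hcard.const_mul_atTop hc))
      exact h1.eventually (eventually_le_nhds (by norm_num))
    filter_upwards [hconc bc, hsmall] with N hN h2
    set μ := isingMeasure (zdGraph d) (box d N) β (h + s) bc
    have hcompl : {σ : SpinConfig (Site d) | |(∑ x ∈ box d N, spinAt x σ) / #(box d N) - D / β| < δ} =
        {σ | δ ≤ |(∑ x ∈ box d N, spinAt x σ) / #(box d N) - D / β|}ᶜ := by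
      ext σ; simp only [mem_setOf_eq, mem_compl_iff, not_le]
    have hmeas : MeasurableSet {σ : SpinConfig (Site d) | δ ≤ |(∑ x ∈ box d N, spinAt x σ) / #(box d N) - D / β|} :=
      measurableSet_le measurable_const (((measurable_sum_spinAt (box d N)).div_const _).sub_const _).abs
    rw [hcompl, measureReal_compl hmeas, probReal_univ]
    linarith
  have h1 := eventually_exp_le_measureReal_window hd β h s bc (D / β) δ hW hε
  have hsD : β * s * (D / β) = s * D := by field_simp
  simpa only [hsD] using h1

/-! ### The Legendre transform at exposed points and the coexistence plateau -/

/-- **Tangent lines lie below the convex `ψ(β,·)`**: `ψ(β,k) + D (u − k) ≤ ψ(β,u)` for every `u`, when `ψ'(k) = D`.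
[cite: FriedliVelenik2017, Thm. 3.6 (convexity of the pressure)] -/
theorem pressure_tangent_le {β k D : ℝ} (hD : HasDerivAt (fun t => pressure d β t) D k) (u : ℝ) :
    pressure d β k + D * (u - k) ≤ pressure d β u := by
  have hconv := IsingSusceptibility.convexOn_pressure_field (d := d) β
  rcases lt_trichotomy u k with hu | rfl | hu
  · have h1 := hconv.slope_le_of_hasDerivAt (mem_univ u) (mem_univ k) hu hD
    rw [slope_def_field] at h1
    have h2 := (div_le_iff₀ (sub_pos.2 hu)).1 h1
    linarith
  · simp
  · have h1 := hconv.le_slope_of_hasDerivAt (mem_univ k) (mem_univ u) hu hD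
    rw [slope_def_field] at h1
    have h2 := (le_div_iff₀ (sub_pos.2 hu)).1 h1
    linarith

/-- **THE LEGENDRE TRANSFORM IS ATTAINED AT THE EXPOSING FIELD**: if `ψ'(β,·)(h+s) = βm` then for every real `u`,
`βum − (ψ(β,h+u) − ψ(β,h)) ≤ βsm − (ψ(β,h+s) − ψ(β,h))`, i.e. `I_{β,h}(m) = sup_u {…}` is attained at `u = s`: the
exponent of `ld_lower_bound_of_hasDerivAt` equals the exponent of the upper bound (the tangent line at `h + s` lies
below the convex `ψ(β,·)`). [cite: Ellis2006, (2.28) and §IV.5 eq. (4.34)] -/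
theorem rate_le_rate_of_hasDerivAt {β h s m : ℝ} (hD : HasDerivAt (fun t => pressure d β t) (β * m) (h + s))
    (u : ℝ) :
    β * u * m - (pressure d β (h + u) - pressure d β h) ≤ β * s * m - (pressure d β (h + s) - pressure d β h) := by
  have := pressure_tangent_le (d := d) hD (h + u)
  nlinarith

/-- **THE RATE IS NONPOSITIVE BETWEEN THE ONE-SIDED SLOPES**: if `∂⁻ψ/∂h (β,h) = Dl ≤ βm ≤ Dr = ∂⁺ψ/∂h (β,h)` then
`βum − (ψ(β,h+u) − ψ(β,h)) ≤ 0` for every `u` (convexity: right chords `≥ Dr`, left chords `≤ Dl`); so the Legendre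
transform `I_{β,h}` vanishes on `[Dl/β, Dr/β]`. [cite: Ellis2006, Example II.6.2 and Thm. V.6.1 (d)–(e)] -/
theorem rate_nonpos_of_mem_Icc {β h Dl Dr m : ℝ} (hR : HasDerivWithinAt (fun t => pressure d β t) Dr (Ici h) h)
    (hL : HasDerivWithinAt (fun t => pressure d β t) Dl (Iic h) h) (hm : Dl ≤ β * m ∧ β * m ≤ Dr) (u : ℝ) :
    β * u * m - (pressure d β (h + u) - pressure d β h) ≤ 0 := by
  have hconv := IsingSusceptibility.convexOn_pressure_field (d := d) β
  rcases lt_trichotomy u 0 with hu | rfl | hu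
  · -- left chord: `slope ψ (h+u) h ≤ Dl`
    have hlt : h + u < h := by linarith
    have h1 := hconv.slope_le_of_hasDerivWithinAt_Iio (mem_univ _) (mem_univ _) hlt (hL.mono Iio_subset_Iic_self)
    rw [slope_def_field] at h1
    have hpos : 0 < h - (h + u) := by linarith
    have h2 := (div_le_iff₀ hpos).1 h1
    nlinarith [hm.1]
  · simp
  · -- right chord: `Dr ≤ slope ψ h (h+u)`
    have hlt : h < h + u := by linarith
    have h1 := hconv.le_slope_of_hasDerivWithinAt_Ioi (mem_univ _) (mem_univ _) hlt (hR.mono Ioi_subset_Ici_self)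
    rw [slope_def_field] at h1
    have hpos : 0 < h + u - h := by linarith
    have h2 := (le_div_iff₀ hpos).1 h1
    nlinarith [hm.2]

/-- **THE COEXISTENCE PLATEAU AT ZERO FIELD: `I_{β,0}(m) = 0` FOR `|m| ≤ m*(β)`** (`d ≥ 1`, `β ≥ 0`): for every `u`,
`βum − (ψ(β,u) − ψ(β,0)) ≤ 0` — the volume-order large-deviation rate of the magnetisation density vanishes on the
whole segment `[−m*(β), m*(β)]` between the one-sided slopes `∓β m*(β)` of the pressure at `h = 0`
(phase coexistence; the true cost there is of surface order). [cite: Ellis2006, Thm. V.6.1 (d)–(e) and Note 13 to Ch. IV; FriedliVelenik2017, Prop. 3.29] -/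
theorem rate_nonpos_zero_field_of_abs_le_spontaneousMagnetization (hd : 1 ≤ d) {β : ℝ} (hβ : 0 ≤ β) {m : ℝ}
    (hm : |m| ≤ spontaneousMagnetization d β) (u : ℝ) :
    β * u * m - (pressure d β u - pressure d β 0) ≤ 0 := by
  have h := rate_nonpos_of_mem_Icc (d := d) (IsingSusceptibility.hasDerivWithinAt_pressure_field_zero hd hβ)
    (IsingSusceptibility.hasDerivWithinAt_pressure_field_zero_left hd hβ) (m := m)
    ⟨by nlinarith [neg_abs_le m, abs_le.1 hm], by nlinarith [le_abs_self m]⟩ u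
  simpa only [zero_add] using h

/-! ### Zero field: the large-deviation principle at the exposed points `±m(β,k)`, `k > 0` -/

/-- **`0 < I_k := βk m(β,k) − (ψ(β,k) − ψ(β,0))` for every `k > 0`** (`d ≥ 1`, `β > 0`): `m(β,k) > m*(β)` (strict
monotonicity of `m(β,·)`), so some rate at `h = 0` is positive (`∂⁺ψ/∂h(β,0) = βm* < βm(β,k)`), and the rate at the
exposing field `k` dominates every other (`rate_le_rate_of_hasDerivAt`). [cite: Ellis2006, Thm. II.6.1 (a)–(b) and §IV.5 eq. (4.34)] -/
theorem rate_pos_zero_field (hd : 1 ≤ d) {β : ℝ} (hβ : 0 < β) {k : ℝ} (hk : 0 < k) :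
    0 < β * k * magnetizationInField d β k - (pressure d β k - pressure d β 0) := by
  have hmk : spontaneousMagnetization d β < magnetizationInField d β k := by
    rw [← magnetizationInField_zero]
    exact IsingSusceptibility.strictMonoOn_magnetizationInField (d := d) hβ (mem_Ici.2 le_rfl) (mem_Ici.2 hk.le) hk
  obtain ⟨s, -, hrate⟩ := exists_rate_pos_of_hasDerivWithinAt_Ici (d := d)
    (IsingSusceptibility.hasDerivWithinAt_pressure_field_zero hd hβ.le) (mul_lt_mul_of_pos_left hmk hβ)
  have hD : HasDerivAt (fun t => pressure d β t) (β * magnetizationInField d β k) (0 + k) := by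
    rw [zero_add]; exact IsingSusceptibility.hasDerivAt_pressure_field hd hβ.le hk
  have hle := rate_le_rate_of_hasDerivAt (d := d) hD s
  simp only [zero_add] at hle hrate
  exact hrate.trans_le hle

/-- **`I_k` is the Legendre transform value at `m(β,k)`**: `βu m(β,k) − (ψ(β,u) − ψ(β,0)) ≤ I_k` for every real `u`
(`k > 0`, `d ≥ 1`, `β > 0`). [cite: Ellis2006, (2.28) and §IV.5 eq. (4.34)] -/
theorem rate_zero_field_le_rate (hd : 1 ≤ d) {β : ℝ} (hβ : 0 < β) {k : ℝ} (hk : 0 < k) (u : ℝ) :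
    β * u * magnetizationInField d β k - (pressure d β u - pressure d β 0) ≤
      β * k * magnetizationInField d β k - (pressure d β k - pressure d β 0) := by
  have hD : HasDerivAt (fun t => pressure d β t) (β * magnetizationInField d β k) (0 + k) := by
    rw [zero_add]; exact IsingSusceptibility.hasDerivAt_pressure_field hd hβ.le hk
  simpa only [zero_add] using rate_le_rate_of_hasDerivAt (d := d) hD u

/-- **LDP AT ZERO FIELD, UPPER BOUND AT `a = m(β,k)`** (`k > 0`, `d ≥ 1`, `β > 0`): for every `ε > 0` and every boundary
condition, eventually `μ^{bc}_{Λ_N;β,0}{M_N ≥ m(β,k)|Λ_N|} ≤ exp(−|Λ_N| (I_k − ε))`. [cite: Ellis2006, Thm. II.6.1 (b) with §IV.5 (4.33)–(4.34)] -/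
theorem ld_upper_zero_field {β : ℝ} (hβ : 0 < β) {k : ℝ} (hk : 0 < k) {ε : ℝ} (hε : 0 < ε)
    (bc : BoundaryCondition (Site d)) :
    ∀ᶠ N : ℕ in atTop,
      (isingMeasure (zdGraph d) (box d N) β 0 bc).real
          {σ | magnetizationInField d β k * #(box d N) ≤ ∑ x ∈ box d N, spinAt x σ} ≤
        Real.exp (-(#(box d N) *
          (β * k * magnetizationInField d β k - (pressure d β k - pressure d β 0) - ε))) := by
  simpa only [zero_add] using
    eventually_measureReal_le_sum_spinAt_le (d := d) (mul_nonneg hβ.le hk.le) 0 bc (magnetizationInField d β k) hε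

/-- **LDP AT ZERO FIELD, LOWER BOUND AT `a = m(β,k)`** (`k > 0`, `d ≥ 1`, `β > 0`): for every `δ, ε > 0` and every
boundary condition, eventually `exp(−|Λ_N| (I_k + βkδ + ε)) ≤ μ^{bc}_{Λ_N;β,0}{|M_N/|Λ_N| − m(β,k)| < δ}`.
[cite: Ellis2006, Thm. II.6.1 (c) with §IV.5 (4.33)–(4.34)] -/
theorem ld_lower_zero_field (hd : 1 ≤ d) {β : ℝ} (hβ : 0 < β) {k : ℝ} (hk : 0 < k) {δ : ℝ} (hδ : 0 < δ) {ε : ℝ}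
    (hε : 0 < ε) (bc : BoundaryCondition (Site d)) :
    ∀ᶠ N : ℕ in atTop,
      Real.exp (-(#(box d N) *
          (β * k * magnetizationInField d β k - (pressure d β k - pressure d β 0) + β * k * δ + ε))) ≤
        (isingMeasure (zdGraph d) (box d N) β 0 bc).real
          {σ | |(∑ x ∈ box d N, spinAt x σ) / #(box d N) - magnetizationInField d β k| < δ} := by
  have hD : HasDerivAt (fun t => pressure d β t) (β * magnetizationInField d β k) (0 + k) := by
    rw [zero_add]; exact IsingSusceptibility.hasDerivAt_pressure_field hd hβ.le hk
  have hβk : |β * k| = β * k := abs_of_pos (mul_pos hβ hk)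
  filter_upwards [ld_lower_bound_of_hasDerivAt hd hβ hD hδ hε bc] with N hN
  rw [zero_add, mul_div_cancel_left₀ _ hβ.ne', hβk] at hN
  convert hN using 3
  ring

/-- **MIRROR IMAGE, UPPER BOUND AT `a = −m(β,k)`**: eventually `μ^{bc}_{Λ_N;β,0}{M_N ≤ −m(β,k)|Λ_N|} ≤ exp(−|Λ_N| (I_k − ε))`
(`ψ(β,·)` is even). [cite: Ellis2006, Thm. II.6.1 (b); FriedliVelenik2017, §3.7.1] -/
theorem ld_upper_zero_field_neg {β : ℝ} (hβ : 0 < β) {k : ℝ} (hk : 0 < k) {ε : ℝ} (hε : 0 < ε)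
    (bc : BoundaryCondition (Site d)) :
    ∀ᶠ N : ℕ in atTop,
      (isingMeasure (zdGraph d) (box d N) β 0 bc).real
          {σ | ∑ x ∈ box d N, spinAt x σ ≤ -magnetizationInField d β k * #(box d N)} ≤
        Real.exp (-(#(box d N) *
          (β * k * magnetizationInField d β k - (pressure d β k - pressure d β 0) - ε))) := by
  have h1 := eventually_measureReal_sum_spinAt_le_le (d := d) (mul_nonneg hβ.le hk.le) 0 bc
    (-magnetizationInField d β k) hε
  simpa only [zero_sub, IsingSusceptibility.pressure_neg_field, mul_neg, neg_neg] using h1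

/-- **MIRROR IMAGE, LOWER BOUND AT `a = −m(β,k)`**: eventually
`exp(−|Λ_N| (I_k + βkδ + ε)) ≤ μ^{bc}_{Λ_N;β,0}{|M_N/|Λ_N| + m(β,k)| < δ}` (`ψ'(−k) = −βm(β,k)`).
[cite: Ellis2006, Thm. II.6.1 (c); FriedliVelenik2017, §3.7.1] -/
theorem ld_lower_zero_field_neg (hd : 1 ≤ d) {β : ℝ} (hβ : 0 < β) {k : ℝ} (hk : 0 < k) {δ : ℝ} (hδ : 0 < δ)
    {ε : ℝ} (hε : 0 < ε) (bc : BoundaryCondition (Site d)) :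
    ∀ᶠ N : ℕ in atTop,
      Real.exp (-(#(box d N) *
          (β * k * magnetizationInField d β k - (pressure d β k - pressure d β 0) + β * k * δ + ε))) ≤
        (isingMeasure (zdGraph d) (box d N) β 0 bc).real
          {σ | |(∑ x ∈ box d N, spinAt x σ) / #(box d N) + magnetizationInField d β k| < δ} := by
  have hD : HasDerivAt (fun t => pressure d β t) (-(β * magnetizationInField d β k)) (0 + -k) := by
    rw [zero_add]
    have := IsingSusceptibility.hasDerivAt_pressure_field_of_neg hd hβ.le (neg_neg_of_pos hk)
    simpa only [neg_neg] using this
  have hβk : |β * -k| = β * k := by rw [mul_neg, abs_neg, abs_of_pos (mul_pos hβ hk)]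
  filter_upwards [ld_lower_bound_of_hasDerivAt hd hβ hD hδ hε bc] with N hN
  rw [zero_add, IsingSusceptibility.pressure_neg_field, neg_div, mul_div_cancel_left₀ _ hβ.ne', hβk] at hN
  simp only [sub_neg_eq_add] at hN
  convert hN using 3
  ring

/-- **EVERY `a ∈ (m*(β), 1)` IS AN EXPOSED POINT: `a = m(β,k)` for some field `k > 0`** (`β > 0`; `m(β,·)` is continuous
on `(0,∞)` with limits `m*(β)` at `0⁺` and `1` at `∞`; intermediate value theorem). Hence the bounds above give the
large-deviation principle with the convex rate `I_{β,0}` at every density `a` with `m*(β) < |a| < 1`.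
[cite: Ellis2006, Thm. II.6.1 and Thm. V.6.1; FriedliVelenik2017, Thm. 3.43 and Exercise 3.18] -/
theorem exists_pos_field_magnetizationInField_eq {β : ℝ} (hβ : 0 < β) {a : ℝ}
    (ha : spontaneousMagnetization d β < a) (ha1 : a < 1) :
    ∃ k : ℝ, 0 < k ∧ magnetizationInField d β k = a := by
  set m : ℝ → ℝ := fun t => magnetizationInField d β t with hm
  obtain ⟨k₁, hk₁a, hk₁⟩ : ∃ k₁ : ℝ, m k₁ < a ∧ 0 < k₁ := by
    have h1 : ∀ᶠ t in 𝓝[>] (0 : ℝ), m t < a :=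
      (IsingSusceptibility.tendsto_magnetizationInField_nhdsGT_zero (d := d) hβ.le).eventually (gt_mem_nhds ha)
    exact (h1.and (eventually_mem_nhdsWithin (a := (0 : ℝ)) (s := Ioi 0))).exists
  obtain ⟨k₂, hk₂a, hk₂⟩ : ∃ k₂ : ℝ, a < m k₂ ∧ k₁ ≤ k₂ := by
    have h1 : ∀ᶠ t in atTop, a < m t :=
      (IsingSusceptibility.tendsto_magnetizationInField_atTop_field (d := d) hβ).eventually (lt_mem_nhds ha1)
    exact (h1.and (eventually_ge_atTop k₁)).exists
  have hcont : ContinuousOn m (Icc k₁ k₂) := by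
    have h := (IsingSusceptibility.concaveOn_magnetizationInField (d := d) hβ.le).continuousOn_interior
    rw [interior_Ici] at h
    exact h.mono fun t ht => hk₁.trans_le ht.1
  obtain ⟨k, hk, hka⟩ := intermediate_value_Icc hk₂ hcont ⟨hk₁a.le, hk₂a.le⟩
  exact ⟨k, hk₁.trans_le hk.1, hka⟩

end IsingLargeDeviations

end Summit.CriticalPhenomena.PercolationContinuityZ3.Theorems.FK
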